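import Literature.Analysis.FluidPDE.SpaceTimeRescaling
import Literature.Analysis.FluidPDE.SuitableWeakProofs
import Literature.Analysis.FluidPDE.NSBoundedInteriorRegularity
import HarnessLib

/-!
# Regular points, the singular set and `𝒫^s` under the space–time rescalings

Analysis/FluidPDE support file, companion of `SpaceTimeRescaling.lean` and
`SuitableWeakRescaling.lean` (covariance of distributional / suitable weak solutions under the
affine maps `Φ(s, y) = (t₀ + β s, x₀ + γ y)`, `β, γ > 0`, and the rescaled fields
`α • stPull β γ t₀ x₀ u = α u ∘ Φ`). Here the notions of Caffarelli–Kohn–Nirenberg 1982, §6 are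
transported along the same maps, for the **whole** two-parameter family (parabolic zooms
`β = γ²`, under which suitable weak solutions keep their viscosity, as well as the
viscosity-normalising dilations `β ≠ γ²`):

* `stAffine_preimage_parabolicCylinderCentered_subset` — `Φ⁻¹(Q*_r(z)) ⊆ Q*_{c r}(Φ⁻¹ z)` for any
  `c` with `γ⁻¹ ≤ c`, `β⁻¹ ≤ c²`;
* `parabolicHausdorffContent_preimage_stAffine_le`, `parabolicHausdorff_preimage_stAffine_le` —
  the quantitative comparison `𝒫^s_{cδ}(Φ⁻¹ X) ≤ c^s 𝒫^s_δ(X)`, `𝒫^s(Φ⁻¹ X) ≤ c^s 𝒫^s(X)` for the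
  parabolic Hausdorff content / measure of CKN (2.6) (`parabolicHausdorffContent`,
  `parabolicHausdorff`), valid for every real `s`;
* `IsParabolicNull.preimage_stAffine`, `IsParabolicNull.image_stAffine` — `𝒫^s`-null sets are
  preserved by `Φ` and `Φ⁻¹`;
* `IsRegularPoint.smul_stPull`, `IsRegularPoint.of_smul_stPull` — `z` is a regular point
  (`IsRegularPoint`: essentially bounded on a centred cylinder) of `α u ∘ Φ` iff `Φ z` is a regular
  point of `u` (`α ≠ 0` for the converse);
* `singularSet_eq_image_singularSet_smul_stPull` — `S(u; Q) = Φ(S(α u ∘ Φ; Φ⁻¹ Q))` for the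
  singular sets (`singularSet`).

The special case `γ = 1`, `α = β = ν⁻¹`, `(t₀, x₀) = 0` (the normalisation `ν = 1` of CKN's §1) is
what `CKNTheoremBViscosity.lean` uses to pass from Theorem B at unit viscosity to every viscosity
(`isParabolicNull_image_stAffine`, `isRegularPoint_of_viscosity_rescale` there); the parabolic
case `β = r²`, `γ = r` says that regular and singular points, and `𝒫^s`-null sets, are invariant
under the Navier–Stokes scaling `u ↦ r u(t₀ + r² s, x₀ + r y)` (Caffarelli–Kohn–Nirenberg 1982,
§2, scaling remarks after (2.6); §6). Everything is elementary: covers by centred cylinders are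
mapped to covers by centred cylinders of comparable radii, and essential bounds are transported
along the measurable bijection `Φ`, which scales Lebesgue measure (`ae_restrict_preimage_stAffine`).

## References

* L. Caffarelli, R. Kohn, L. Nirenberg, *Partial regularity of suitable weak solutions of the
  Navier–Stokes equations*, Comm. Pure Appl. Math. 35 (1982), 771–831, §2 ((2.6) and the
  scaling remarks), §6 (regular points, Theorem B). [CaffarelliKohnNirenberg1982] [CKN1982]
* J. C. Robinson, J. L. Rodrigo, W. Sadowski, *The Three-Dimensional Navier–Stokes Equations*,
  CUP (2016), §16.3 (PDF p. 244: `𝒫^s`), Thm. 16.2. [RobinsonRodrigoSadowski2016]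
-/

noncomputable section

open MeasureTheory Set Function Filter Topology TopologicalSpace Metric
open scoped NNReal ENNReal

namespace Literature.Analysis.FluidPDE

/-! ### Centred cylinders and `𝒫^s` under the space–time affine maps -/

section Cylinders

variable {E : Type*} [NormedAddCommGroup E] [InnerProductSpace ℝ E]

/-- **Preimages of centred cylinders under `Φ(s, y) = (t₀ + β s, x₀ + γ y)`.** For `β, γ > 0` and
a constant `c` with `γ⁻¹ ≤ c`, `β⁻¹ ≤ c²`, the preimage `Φ⁻¹(Q*_r(t, x)) =
((t - t₀ - r²)/β, (t - t₀ + r²)/β) × B(γ⁻¹(x - x₀), r/γ)` lies in the centred cylinder of radius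
`c r` about `Φ⁻¹(t, x) = (β⁻¹(t - t₀), γ⁻¹(x - x₀))`. [folklore] -/
theorem stAffine_preimage_parabolicCylinderCentered_subset {β γ c : ℝ} (hβ : 0 < β) (hγ : 0 < γ)
    (hcγ : γ⁻¹ ≤ c) (hcβ : β⁻¹ ≤ c ^ 2) (t₀ : ℝ) (x₀ : E) (r : ℝ) (z : ℝ × E) :
    stAffine β γ t₀ x₀ ⁻¹' parabolicCylinderCentered r z ⊆
      parabolicCylinderCentered (c * r) ((β⁻¹ * (z.1 - t₀), γ⁻¹ • (z.2 - x₀)) : ℝ × E) := by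
  rintro ⟨s, y⟩ hw
  rw [mem_preimage, mem_parabolicCylinderCentered, stAffine_fst, stAffine_snd] at hw
  obtain ⟨⟨h1, h2⟩, h3⟩ := hw
  have hr : 0 < r := dist_nonneg.trans_lt h3
  rw [mem_parabolicCylinderCentered]
  refine ⟨?_, ?_⟩
  · -- time: `|β s - (z.1 - t₀)| < r²`, so `|s - β⁻¹ (z.1 - t₀)| < r² / β ≤ (c r)²`
    have hβ' : β⁻¹ * (z.1 - t₀) - s = β⁻¹ * ((z.1 - t₀) - β * s) := by
      rw [mul_sub β⁻¹ (z.1 - t₀) (β * s), ← mul_assoc β⁻¹ β s, inv_mul_cancel₀ hβ.ne', one_mul]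
    have habs : |(z.1 - t₀) - β * s| < r ^ 2 := abs_sub_lt_iff.2 ⟨by linarith, by linarith⟩
    have hkey : |β⁻¹ * (z.1 - t₀) - s| < (c * r) ^ 2 := by
      rw [hβ', abs_mul, abs_of_pos (inv_pos.2 hβ), mul_pow]
      calc β⁻¹ * |z.1 - t₀ - β * s| < β⁻¹ * r ^ 2 :=
            mul_lt_mul_of_pos_left habs (inv_pos.2 hβ)
        _ ≤ c ^ 2 * r ^ 2 := mul_le_mul_of_nonneg_right hcβ (sq_nonneg r)
    constructor <;> [have := (abs_sub_lt_iff.1 hkey).1; have := (abs_sub_lt_iff.1 hkey).2] <;>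
      dsimp only <;> linarith
  · -- space: `‖y - γ⁻¹ (z.2 - x₀)‖ = γ⁻¹ ‖(x₀ + γ y) - z.2‖ < γ⁻¹ r ≤ c r`
    dsimp only
    rw [dist_eq_norm] at h3 ⊢
    have e : y - γ⁻¹ • (z.2 - x₀) = γ⁻¹ • (x₀ + γ • y - z.2) := by
      rw [smul_sub, smul_sub, smul_add, smul_smul, inv_mul_cancel₀ hγ.ne', one_smul]
      abel
    rw [e, norm_smul, Real.norm_eq_abs, abs_of_pos (inv_pos.2 hγ)]
    calc γ⁻¹ * ‖x₀ + γ • y - z.2‖ < γ⁻¹ * r := mul_lt_mul_of_pos_left h3 (inv_pos.2 hγ)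
      _ ≤ c * r := mul_le_mul_of_nonneg_right hcγ hr.le

/-- **The `δ`-content under `Φ`.** With `c > 0` as above and any real `s`:
`𝒫^s_{cδ}(Φ⁻¹ X) ≤ c^s 𝒫^s_δ(X)` — an admissible `δ`-cover `{Q*_{rⱼ}(zⱼ)}` of `X` pulls back to
the admissible `cδ`-cover `{Q*_{c rⱼ}(Φ⁻¹ zⱼ)}` of `Φ⁻¹(X)`, of cost `Σ (c rⱼ)^s = c^s Σ rⱼ^s`
(Caffarelli–Kohn–Nirenberg 1982, (2.6); Robinson–Rodrigo–Sadowski 2016, §16.3). The bound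
`𝒫^s_δ(X) < a` is unfolded into a near-optimal cover (`exists_cover_of_parabolicHausdorffContent_lt`)
for every `a > 𝒫^s_δ(X)`. [cite: CKN1982, (2.6)] -/
theorem parabolicHausdorffContent_preimage_stAffine_le {β γ c : ℝ} (hβ : 0 < β) (hγ : 0 < γ)
    (hc : 0 < c) (hcγ : γ⁻¹ ≤ c) (hcβ : β⁻¹ ≤ c ^ 2) (t₀ : ℝ) (x₀ : E) (s δ : ℝ)
    (X : Set (ℝ × E)) :
    parabolicHausdorffContent s (c * δ) (stAffine β γ t₀ x₀ ⁻¹' X) ≤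
      ENNReal.ofReal (c ^ s) * parabolicHausdorffContent s δ X := by
  set K : ℝ≥0∞ := ENNReal.ofReal (c ^ s) with hK
  have hK0 : K ≠ 0 := (ENNReal.ofReal_pos.2 (Real.rpow_pos_of_pos hc s)).ne'
  have hKt : K ≠ ∞ := ENNReal.ofReal_ne_top
  refine le_of_forall_gt_imp_ge_of_dense fun a ha => ?_
  have hlt : parabolicHausdorffContent s δ X < a / K := by
    rw [ENNReal.lt_div_iff_mul_lt (Or.inl hK0) (Or.inl hKt), mul_comm]
    exact ha
  obtain ⟨z, r, hr, hX, hcost⟩ := exists_cover_of_parabolicHausdorffContent_lt hlt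
  calc parabolicHausdorffContent s (c * δ) (stAffine β γ t₀ x₀ ⁻¹' X)
      ≤ ∑' j, ENNReal.ofReal ((c * r j) ^ s) := by
        refine iInf_le_of_le (fun j => ((β⁻¹ * ((z j).1 - t₀), γ⁻¹ • ((z j).2 - x₀)) : ℝ × E)) <|
          iInf_le_of_le (fun j => c * r j) <|
          iInf_le_of_le (fun j => ⟨mul_nonneg hc.le (hr j).1,
            mul_lt_mul_of_pos_left (hr j).2 hc⟩) <| iInf_le_of_le ?_ le_rfl
        refine (preimage_mono hX).trans ?_
        rw [preimage_iUnion]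
        exact iUnion_mono fun j =>
          stAffine_preimage_parabolicCylinderCentered_subset hβ hγ hcγ hcβ t₀ x₀ (r j) (z j)
    _ = K * ∑' j, ENNReal.ofReal (r j ^ s) := by
        rw [hK, ← ENNReal.tsum_mul_left]
        refine tsum_congr fun j => ?_
        rw [Real.mul_rpow hc.le (hr j).1, ENNReal.ofReal_mul (Real.rpow_nonneg hc.le s)]
    _ ≤ K * (a / K) := mul_le_mul' le_rfl hcost.le
    _ = a := ENNReal.mul_div_cancel hK0 hKt

/-- **`𝒫^s` under `Φ`**: `𝒫^s(Φ⁻¹ X) ≤ c^s 𝒫^s(X)` for `Φ = stAffine β γ t₀ x₀`, `β, γ > 0`,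
`c > 0` with `γ⁻¹ ≤ c`, `β⁻¹ ≤ c²`, and any real `s` (supremum over `δ > 0` of
`parabolicHausdorffContent_preimage_stAffine_le` at `δ / c`; Caffarelli–Kohn–Nirenberg 1982,
(2.6)). [cite: CKN1982, (2.6)] -/
theorem parabolicHausdorff_preimage_stAffine_le {β γ c : ℝ} (hβ : 0 < β) (hγ : 0 < γ)
    (hc : 0 < c) (hcγ : γ⁻¹ ≤ c) (hcβ : β⁻¹ ≤ c ^ 2) (t₀ : ℝ) (x₀ : E) (s : ℝ)
    (X : Set (ℝ × E)) :
    parabolicHausdorff s (stAffine β γ t₀ x₀ ⁻¹' X) ≤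
      ENNReal.ofReal (c ^ s) * parabolicHausdorff s X := by
  refine iSup₂_le fun δ hδ => ?_
  have e : δ = c * (δ / c) := by field_simp
  calc parabolicHausdorffContent s δ (stAffine β γ t₀ x₀ ⁻¹' X)
      = parabolicHausdorffContent s (c * (δ / c)) (stAffine β γ t₀ x₀ ⁻¹' X) := by rw [← e]
    _ ≤ ENNReal.ofReal (c ^ s) * parabolicHausdorffContent s (δ / c) X :=
        parabolicHausdorffContent_preimage_stAffine_le hβ hγ hc hcγ hcβ t₀ x₀ s _ X
    _ ≤ ENNReal.ofReal (c ^ s) * parabolicHausdorff s X :=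
        mul_le_mul' le_rfl
          (le_iSup₂ (f := fun (δ : ℝ) (_ : 0 < δ) => parabolicHausdorffContent s δ X) (δ / c)
            (by positivity))

/-- **`𝒫^s`-null sets are preserved by preimages under the space–time affine maps**
`Φ(s, y) = (t₀ + β s, x₀ + γ y)`, `β, γ > 0` (any real `s`): with `c = max(γ⁻¹, 1, β⁻¹)` (so that
`γ⁻¹ ≤ c` and `β⁻¹ ≤ c ≤ c²`) one has `𝒫^s(Φ⁻¹ X) ≤ c^s 𝒫^s(X) = 0` (Caffarelli–Kohn–Nirenberg
1982, (2.6) and the scaling remarks of §2). [cite: CKN1982, (2.6)] -/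
theorem IsParabolicNull.preimage_stAffine {s : ℝ} {X : Set (ℝ × E)}
    (hX : IsParabolicNull s X) {β γ : ℝ} (hβ : 0 < β) (hγ : 0 < γ) (t₀ : ℝ) (x₀ : E) :
    IsParabolicNull s (stAffine β γ t₀ x₀ ⁻¹' X) := by
  set c : ℝ := max γ⁻¹ (max 1 β⁻¹) with hc
  have hc1 : 1 ≤ c := (le_max_left _ _).trans (le_max_right _ _)
  have hc0 : 0 < c := one_pos.trans_le hc1
  have hcγ : γ⁻¹ ≤ c := le_max_left _ _
  have hcβ : β⁻¹ ≤ c ^ 2 :=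
    ((le_max_right _ _).trans (le_max_right _ _)).trans (by nlinarith)
  have h := parabolicHausdorff_preimage_stAffine_le hβ hγ hc0 hcγ hcβ t₀ x₀ s X
  rw [hX, mul_zero] at h
  exact le_antisymm h zero_le

/-- **`𝒫^s`-null sets are preserved by images under the space–time affine maps** (`β, γ > 0`,
any real `s`): `Φ(X) = (Φ⁻¹)⁻¹(X)` and `Φ⁻¹ = stAffine β⁻¹ γ⁻¹ (-β⁻¹t₀) (-γ⁻¹x₀)` is again such a
map (`stAffineHomeomorph_symm_eq`). The case `γ = 1` is `isParabolicNull_image_stAffine` of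
`CKNTheoremBViscosity.lean`. [cite: CKN1982, (2.6)] -/
theorem IsParabolicNull.image_stAffine {s : ℝ} {X : Set (ℝ × E)}
    (hX : IsParabolicNull s X) {β γ : ℝ} (hβ : 0 < β) (hγ : 0 < γ) (t₀ : ℝ) (x₀ : E) :
    IsParabolicNull s (stAffine β γ t₀ x₀ '' X) := by
  have e : stAffine β γ t₀ x₀ '' X = (stAffineHomeomorph hβ.ne' hγ.ne' t₀ x₀).symm ⁻¹' X :=
    (stAffineHomeomorph hβ.ne' hγ.ne' t₀ x₀).image_eq_preimage_symm X
  rw [e, stAffineHomeomorph_symm_eq hβ.ne' hγ.ne']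
  exact hX.preimage_stAffine (inv_pos.2 hβ) (inv_pos.2 hγ) _ _

end Cylinders

/-! ### Regular points and the singular set under rescaling -/

section Regular

variable {E : Type*} [NormedAddCommGroup E] [InnerProductSpace ℝ E] [FiniteDimensional ℝ E]
  [MeasurableSpace E] [BorelSpace E]

/-- **Regular points pull back along the rescaling.** If `Φ z` is a regular point of `u`
(`u ∈ L^∞(Q*_r(Φ z))` for some `r > 0`), then `z` is a regular point of the rescaled field
`α u ∘ Φ`, `Φ(s, y) = (t₀ + β s, x₀ + γ y)`, `β, γ > 0`: the essential bound transports to the open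
set `Φ⁻¹(Q*_r(Φ z)) ∋ z` (`Φ` is a measurable bijection scaling Lebesgue measure), which contains a
small centred cylinder about `z` (Caffarelli–Kohn–Nirenberg 1982, §2 and §6: the notions are
scale invariant). [cite: CKN1982, §6] -/
theorem IsRegularPoint.smul_stPull {u : ℝ → E → E} {β γ : ℝ} (hβ : 0 < β) (hγ : 0 < γ) {t₀ : ℝ}
    {x₀ : E} {z : ℝ × E} (h : IsRegularPoint u (stAffine β γ t₀ x₀ z)) (α : ℝ) :
    IsRegularPoint (α • stPull β γ t₀ x₀ u) z := by
  obtain ⟨r, hr, hb⟩ := h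
  set S : Set (ℝ × E) := parabolicCylinderCentered r (stAffine β γ t₀ x₀ z) with hS
  set M : ℝ≥0∞ := eLpNorm (uncurry u) ∞ (volume.restrict S) with hM
  have hMae : ∀ᵐ w ∂(volume.restrict S), ‖uncurry u w‖ₑ ≤ M := by
    rw [hM, eLpNorm_exponent_top]
    exact ae_le_eLpNormEssSup
  have htr : ∀ᵐ w ∂(volume.restrict (stAffine β γ t₀ x₀ ⁻¹' S)),
      ‖uncurry u (stAffine β γ t₀ x₀ w)‖ₑ ≤ M :=
    ae_restrict_preimage_stAffine hβ hγ t₀ x₀ hMae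
  have hopen : IsOpen (stAffine β γ t₀ x₀ ⁻¹' S) :=
    (isOpen_parabolicCylinderCentered _ _).preimage (continuous_stAffine β γ t₀ x₀)
  have hzS : z ∈ stAffine β γ t₀ x₀ ⁻¹' S :=
    mem_parabolicCylinderCentered_self hr _
  obtain ⟨ρ, hρ, -, hsub⟩ := exists_parabolicCylinderCentered_subset hopen hzS
  refine ⟨ρ, hρ, ?_⟩
  rw [eLpNorm_exponent_top]
  refine (eLpNormEssSup_le_of_ae_enorm_bound (C := ‖α‖ₑ * M) ?_).trans_lt
    (ENNReal.mul_lt_top (by simp) hb)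
  filter_upwards [ae_restrict_of_ae_restrict_of_subset hsub htr] with w hw
  calc ‖uncurry (α • stPull β γ t₀ x₀ u) w‖ₑ = ‖α • uncurry u (stAffine β γ t₀ x₀ w)‖ₑ := rfl
    _ = ‖α‖ₑ * ‖uncurry u (stAffine β γ t₀ x₀ w)‖ₑ := enorm_smul _ _
    _ ≤ ‖α‖ₑ * M := mul_le_mul' le_rfl hw

omit [FiniteDimensional ℝ E] [MeasurableSpace E] [BorelSpace E] in
/-- Undoing the rescaling: `α⁻¹ • ((α • u ∘ Φ) ∘ Φ⁻¹) = u` for `α ≠ 0`. [folklore] -/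
theorem inv_smul_stPull_symm_smul_stPull {F : Type*} [NormedAddCommGroup F] [NormedSpace ℝ F]
    {α β γ : ℝ} (hα : α ≠ 0) (hβ : β ≠ 0) (hγ : γ ≠ 0) (t₀ : ℝ) (x₀ : E) (u : ℝ → E → F) :
    α⁻¹ • stPull β⁻¹ γ⁻¹ (-(β⁻¹ * t₀)) (-(γ⁻¹ • x₀)) (α • stPull β γ t₀ x₀ u) = u := by
  have e : stPull β⁻¹ γ⁻¹ (-(β⁻¹ * t₀)) (-(γ⁻¹ • x₀)) (α • stPull β γ t₀ x₀ u) =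
      α • stPull β⁻¹ γ⁻¹ (-(β⁻¹ * t₀)) (-(γ⁻¹ • x₀)) (stPull β γ t₀ x₀ u) := by
    funext s y; rfl
  rw [e, stPull_symm_stPull hβ hγ, smul_smul, inv_mul_cancel₀ hα, one_smul]

/-- **Regular points push forward along the rescaling** (`α ≠ 0`, `β, γ > 0`): if `z` is a
regular point of `α u ∘ Φ` then `Φ z` is a regular point of `u` — `IsRegularPoint.smul_stPull` for
the inverse map `Φ⁻¹ = stAffine β⁻¹ γ⁻¹ (-β⁻¹t₀) (-γ⁻¹x₀)` and `u = α⁻¹ (α u ∘ Φ) ∘ Φ⁻¹`.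
[cite: CKN1982, §6] -/
theorem IsRegularPoint.of_smul_stPull {u : ℝ → E → E} {α β γ : ℝ} (hα : α ≠ 0) (hβ : 0 < β)
    (hγ : 0 < γ) {t₀ : ℝ} {x₀ : E} {z : ℝ × E}
    (h : IsRegularPoint (α • stPull β γ t₀ x₀ u) z) :
    IsRegularPoint u (stAffine β γ t₀ x₀ z) := by
  have hz : stAffine β⁻¹ γ⁻¹ (-(β⁻¹ * t₀)) (-(γ⁻¹ • x₀)) (stAffine β γ t₀ x₀ z) = z := by
    rw [← stAffineHomeomorph_symm_eq hβ.ne' hγ.ne', stAffineHomeomorph_symm_apply_stAffine]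
  rw [← hz] at h
  have h' := h.smul_stPull (inv_pos.2 hβ) (inv_pos.2 hγ) α⁻¹
  rwa [inv_smul_stPull_symm_smul_stPull hα hβ.ne' hγ.ne'] at h'

/-- **The singular set is covariant**: for `α ≠ 0`, `β, γ > 0`, the singular set of `u` in `Q` is
the image under `Φ` of the singular set of `α u ∘ Φ` in `Φ⁻¹(Q)`
(Caffarelli–Kohn–Nirenberg 1982, §6). [cite: CKN1982, §6] -/
theorem singularSet_eq_image_singularSet_smul_stPull (u : ℝ → E → E) {α β γ : ℝ} (hα : α ≠ 0)
    (hβ : 0 < β) (hγ : 0 < γ) (t₀ : ℝ) (x₀ : E) (Q : Opens (ℝ × E)) :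
    singularSet u (Q : Set (ℝ × E)) =
      stAffine β γ t₀ x₀ '' singularSet (α • stPull β γ t₀ x₀ u)
        ((stPreimage β γ t₀ x₀ Q : Opens (ℝ × E)) : Set (ℝ × E)) := by
  ext z
  simp only [mem_singularSet, mem_image, coe_stPreimage, mem_preimage, SetLike.mem_coe]
  constructor
  · rintro ⟨hzQ, hzs⟩
    refine ⟨(stAffineHomeomorph hβ.ne' hγ.ne' t₀ x₀).symm z, ⟨?_, fun hreg => hzs ?_⟩, ?_⟩
    · rwa [stAffine_apply_symm]
    · have := IsRegularPoint.of_smul_stPull hα hβ hγ hreg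
      rwa [stAffine_apply_symm] at this
    · exact stAffine_apply_symm hβ.ne' hγ.ne' t₀ x₀ z
  · rintro ⟨w, ⟨hwQ, hws⟩, rfl⟩
    exact ⟨hwQ, fun hreg => hws (hreg.smul_stPull hβ hγ α)⟩

end Regular

end Literature.Analysis.FluidPDE
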